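import Literature.Analysis.Complex.RiemannDomainCharPoly
import Literature.Analysis.Complex.MvPolynomialGrowthLipschitz
import Literature.AlgebraicGeometry.FundamentalGroup.RiemannExistenceEtaleCoordinates
import Literature.Topology.CoveringSpaces.FiniteCoveringProper
import Literature.Geometry.Manifold.CoveringSpaceManifold
import HarnessLib

/-!
# Riemann's existence theorem for smooth affine varieties, transcendental input: the case of global
# étale coordinates

Layer `Literature/AlgebraicGeometry/FundamentalGroup`. Let `S` be a smooth affine integral `ℂ`-scheme
of relative dimension `d` carrying global ÉTALE COORDINATES `x : S → 𝔸ᵈ_ℂ`, `q : T → S(ℂ)` a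
topological covering with finite fibres and `P₀ ∈ S(ℂ)`. Then there are a continuous `h : T → ℂ`
injective on `q⁻¹(P₀)` and a NON-ZERO `F ∈ Γ(S, 𝒪_S)[τ]` with `F(q t)(h t) = 0` for all `t`
(`exists_algebraicSeparating_of_etaleCoordinates`). This is SGA 1 XII Thm. 5.1, proof, part 2
(essential surjectivity of `X' ↦ X'^an` on finite étale covers), in all dimensions, for the chart
pieces; `RiemannExistenceSmoothAffine` glues it into `riemannExistence_qbarDescent_of_finiteIndex`.

Proof (Grauert–Remmert via Hörmander's `L²` method, as assembled in the tree):
`T` is a flat Riemann domain over `ℂᵈ` through `proj = x(ℂ) ∘ q` (`RiemannExistenceEtaleCoordinates`,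
`x(ℂ)` is a local biholomorphism); the regular functions are flat-holomorphic on it, so
`s = ∑ |h_m ∘ q|²` over generators `h_m ⊇ {x_k}` of `Γ(S, 𝒪_S)` is a `C^∞` strictly plurisubharmonic
exhaustion (`RiemannDomainHolomorphic`; the generators embed `S(ℂ)` properly in `ℂᴹ`) and
`φ₀ = log(1 + |proj|²)` a strictly plurisubharmonic weight; Hörmander's interpolation theorem
(`RiemannDomain.exists_flatHolomorphic_interpolating`, Thm. 4.4.3–4.4.4) gives a flat-holomorphic `h`
with prescribed distinct values on `q⁻¹(P₀)` in `L²(e^{-φ₀}(1+|proj - x(P₀)|²)^{-d})`; `x` is finite over a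
dense open `{δ ≠ 0}` (`exists_isCompact_preimage_coordMap`), so `proj` is a finite covering there and
`h` has polynomial growth in `(|proj|, |δ(proj)|⁻¹)` on the sheets
(`IsFlatHolomorphic.exists_norm_le_of_memLp`, `MvPolynomial.exists_radius`); hence `δ(proj)^{2d} h` has a
monic characteristic polynomial with POLYNOMIAL coefficients (`RiemannDomain.exists_charPoly_of_isCoveringMapOn`,
Riemann extension + Liouville), which read through `ℂ[X] → Γ(S, 𝒪_S)`, `X ↦ x`, is the sought `F`.

Everything is proved; there are no named facts.

## References

* A. Grothendieck, M. Raynaud, *SGA 1*, Exp. XII Thm. 5.1 (p. 333), proof, part 2. [SGA1]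
* L. Hörmander, *An Introduction to Complex Analysis in Several Variables* (1973), Thm. 4.4.3–4.4.4,
  §5.4, Thm. 7.5.x. [HormanderSCV1973]
* H. Grauert, R. Remmert, *Komplexe Räume*, Math. Ann. 136 (1958), §2 Satz 8. [GrauertRemmert1958]

#harness_tags algebraic_geometry.sga1, complex_geometry.riemann_existence, complex_analysis.several_variables
-/

noncomputable section

open scoped Topology Polynomial Manifold ContDiff ComplexConjugate
open CategoryTheory AlgebraicGeometry Set Filter Function Metric MeasureTheory
open Literature.AlgebraicGeometry.Motives
open Literature.AlgebraicGeometry.Motives.AlgPoints (evalOrZero evalOrZero_of_mem)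
open Literature.NumberTheory.Transcendental
open Literature.Analysis.Complex Literature.Analysis.Complex.RiemannDomain
open Literature.Topology.CoveringSpaces

namespace Literature.AlgebraicGeometry.FundamentalGroup

namespace SmoothAffineCore

open LineProjection HodgeTheory.AffineCoordinates EtaleCoordinates

variable (S : SchemeOver ℂ) [IsAffine S.left] [LocallyOfFiniteType S.hom] [IsIntegral S.left]
  {T : Type} [TopologicalSpace T] {q : T → ComplexPoints S}

/-! ### Functions of polynomial growth on `ℂ^ι` -/

section PolyGrowth

variable {ι : Type*} [Fintype ι]

/-- `f` has polynomial growth: `|f(z)| ≤ C (1 + |z|)^k`. [folklore] -/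
def PolyGrowth (f : (ι → ℂ) → ℝ) : Prop := ∃ C : ℝ, 0 ≤ C ∧ ∃ k : ℕ, ∀ z, |f z| ≤ C * (1 + ‖z‖) ^ k

/-- Constants have polynomial growth. [folklore] -/
theorem PolyGrowth.const (c : ℝ) : PolyGrowth fun _ : ι → ℂ ↦ c :=
  ⟨|c|, abs_nonneg c, 0, fun z ↦ by simp⟩

/-- `|z|` has polynomial growth. [folklore] -/
theorem PolyGrowth.norm : PolyGrowth fun z : ι → ℂ ↦ ‖z‖ :=
  ⟨1, zero_le_one, 1, fun z ↦ by rw [abs_of_nonneg (norm_nonneg z)]; linarith [norm_nonneg z]⟩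

/-- Sums of functions of polynomial growth. [folklore] -/
theorem PolyGrowth.add {f g : (ι → ℂ) → ℝ} (hf : PolyGrowth f) (hg : PolyGrowth g) : PolyGrowth fun z ↦ f z + g z := by
  obtain ⟨C₁, hC₁, k₁, h₁⟩ := hf
  obtain ⟨C₂, hC₂, k₂, h₂⟩ := hg
  refine ⟨C₁ + C₂, by positivity, max k₁ k₂, fun z ↦ (abs_add_le _ _).trans ?_⟩
  have e1 := (h₁ z).trans (mul_le_mul_of_nonneg_left (MvPolynomial.one_add_norm_pow_le_pow z (le_max_left k₁ k₂)) hC₁)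
  have e2 := (h₂ z).trans (mul_le_mul_of_nonneg_left (MvPolynomial.one_add_norm_pow_le_pow z (le_max_right k₁ k₂)) hC₂)
  linarith

/-- Products of functions of polynomial growth. [folklore] -/
theorem PolyGrowth.mul {f g : (ι → ℂ) → ℝ} (hf : PolyGrowth f) (hg : PolyGrowth g) : PolyGrowth fun z ↦ f z * g z := by
  obtain ⟨C₁, hC₁, k₁, h₁⟩ := hf
  obtain ⟨C₂, hC₂, k₂, h₂⟩ := hg
  refine ⟨C₁ * C₂, by positivity, k₁ + k₂, fun z ↦ ?_⟩
  rw [abs_mul, pow_add]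
  calc |f z| * |g z| ≤ (C₁ * (1 + ‖z‖) ^ k₁) * (C₂ * (1 + ‖z‖) ^ k₂) :=
        mul_le_mul (h₁ z) (h₂ z) (abs_nonneg _) (by positivity)
    _ = C₁ * C₂ * ((1 + ‖z‖) ^ k₁ * (1 + ‖z‖) ^ k₂) := by ring

/-- Powers of functions of polynomial growth. [folklore] -/
theorem PolyGrowth.pow {f : (ι → ℂ) → ℝ} (hf : PolyGrowth f) (n : ℕ) : PolyGrowth fun z ↦ f z ^ n := by
  induction n with
  | zero => simpa using PolyGrowth.const (ι := ι) 1
  | succ n ih => simpa [pow_succ] using ih.mul hf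

/-- Domination by a function of polynomial growth. [folklore] -/
theorem PolyGrowth.of_abs_le {f g : (ι → ℂ) → ℝ} (hf : PolyGrowth f) (h : ∀ z, |g z| ≤ |f z|) : PolyGrowth g := by
  obtain ⟨C, hC, k, hk⟩ := hf
  exact ⟨C, hC, k, fun z ↦ (h z).trans (hk z)⟩

end PolyGrowth

/-! ### Local homeomorphisms to a point -/

omit [IsAffine S.left] [LocallyOfFiniteType S.hom] [IsIntegral S.left] in
/-- A space locally homeomorphic to a subsingleton is discrete. [folklore] -/
theorem discreteTopology_of_isLocallyInjective {Y : Type*} [TopologicalSpace Y] [Subsingleton Y] {f : T → Y}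
    (hf : IsLocallyInjective f) : DiscreteTopology T := by
  rw [discreteTopology_iff_isOpen_singleton]
  intro t
  obtain ⟨U, hU, htU, hinj⟩ := hf t
  have : U = {t} := by
    refine Subset.antisymm (fun u hu ↦ ?_) (singleton_subset_iff.2 htU)
    exact hinj hu htU (Subsingleton.elim _ _)
  rw [← this]; exact hU

section Domain

variable (d : ℕ) [SmoothOfRelativeDimension d S.hom] (x : Fin d → Γ(S.left, ⊤)) [Etale (coordHom S x).left]

omit [IsIntegral S.left] in
/-- `x(ℂ)` is a local homeomorphism for `x` étale. [cite: SGA1, Exp. XII Prop. 3.1 (iii)] -/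
theorem isLocalHomeomorph_coordMap : IsLocalHomeomorph (coordMap S x) :=
  IsLocalHomeomorph.mk _ fun P ↦ by
    obtain ⟨e, hP, he, -⟩ := exists_chart_coordMap S d x P
    exact ⟨e, hP, fun Q _ ↦ by rw [he]⟩

/-- **The Riemann domain of a finite-fibred covering over étale coordinates.** For `x : S → 𝔸ᵈ_ℂ`
étale (`S` affine) and `q : T → S(ℂ)` a covering map with finite fibres (`T` Hausdorff, second
countable), `T` is a flat Riemann domain over `ℂᵈ` through `x(ℂ) ∘ q`. [cite: SGA1, Exp. XII Thm. 5.1 (proof, part 2)] -/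
def riemannDomain [T2Space T] [SecondCountableTopology T] (hq : IsCoveringMap q) : RiemannDomain.{0} (Fin d) where
  carrier := T
  proj := coordMap S x ∘ q
  isLocalHomeomorph := (isLocalHomeomorph_coordMap S d x).comp hq.isLocalHomeomorph

omit [IsIntegral S.left] in
/-- **Regular functions are flat-holomorphic** on the Riemann domain of a covering over étale
coordinates. [cite: SGA1, Exp. XII Prop. 3.1 (iii)] -/
theorem isFlatHolomorphic_eval [T2Space T] [SecondCountableTopology T] (hq : IsCoveringMap q) (w : Γ(S.left, ⊤)) :
    IsFlatHolomorphic (riemannDomain S d x hq) fun t : T ↦ (q t).eval ⊤ trivial w := by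
  refine IsFlatHolomorphic.of_local fun t ↦ ?_
  obtain ⟨eq_, ht, heq⟩ := hq.isLocalHomeomorph t
  obtain ⟨ex, hqt, hex, hhol⟩ := exists_chart_coordMap S d x (q t)
  refine ⟨eq_.trans ex, ?_, ?_, ?_⟩
  · funext u
    show ex (eq_ u) = coordMap S x (q u)
    rw [hex, heq]
  · rw [OpenPartialHomeomorph.trans_source]
    exact ⟨ht, by rw [mem_preimage, ← show q t = eq_ t from congr_fun heq t]; exact hqt⟩
  · intro z hz
    rw [OpenPartialHomeomorph.trans_target] at hz
    have h1 : ∀ z' ∈ ex.target ∩ ex.symm ⁻¹' eq_.target,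
        ((fun t : T ↦ (q t).eval ⊤ trivial w) ∘ (eq_.trans ex).symm) z' =
          ((fun Q : ComplexPoints S ↦ Q.eval ⊤ trivial w) ∘ ex.symm) z' := by
      rintro z' ⟨-, hz'⟩
      show (q (eq_.symm (ex.symm z'))).eval ⊤ trivial w = (ex.symm z').eval ⊤ trivial w
      rw [show q (eq_.symm (ex.symm z')) = eq_ (eq_.symm (ex.symm z')) from congr_fun heq _, eq_.right_inv hz']
    exact (((hhol w).mono inter_subset_left).congr h1) z hz

end Domain

/-- **Riemann's existence theorem, transcendental input, in étale coordinates** (SGA 1 XII Thm. 5.1,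
proof, part 2, all dimensions): see the module docstring. [cite: SGA1, Exp. XII Thm. 5.1 (p. 333), proof, part 2]
[cite: HormanderSCV1973, Thm 4.4.3-4.4.4] -/
theorem exists_algebraicSeparating_of_etaleCoordinates (d : ℕ) [SmoothOfRelativeDimension d S.hom]
    (x : Fin d → Γ(S.left, ⊤)) [Etale (coordHom S x).left] (hq : IsCoveringMap q) (hqfin : ∀ P, (q ⁻¹' {P}).Finite)
    (P₀ : ComplexPoints S) :
    ∃ (h : T → ℂ) (F : Polynomial Γ(S.left, ⊤)), Continuous h ∧ F ≠ 0 ∧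
      (∀ t, (F.map ((q t).evalRingHom ⊤ trivial)).eval (h t) = 0) ∧ InjOn h (q ⁻¹' {P₀}) := by
  classical
  -- topology of `T`
  haveI : T2Space (ComplexPoints S) := ComplexPoints.t2Space_of_isSeparated S
  haveI : T2Space T := by
    -- a covering of a Hausdorff space is Hausdorff
    refine ⟨fun t₁ t₂ hne ↦ ?_⟩
    by_cases hqt : q t₁ = q t₂
    · exact hq.isSeparatedMap t₁ t₂ hqt hne
    · obtain ⟨u, v, hu, hv, h₁, h₂, huv⟩ := t2_separation hqt
      exact ⟨q ⁻¹' u, q ⁻¹' v, hu.preimage hq.continuous, hv.preimage hq.continuous, h₁, h₂, huv.preimage q⟩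
  have hqprop : IsProperMap q := hq.isProperMap_of_finite hqfin
  -- the fibre over `P₀`, enumerated
  set F₀ : Finset T := (hqfin P₀).toFinset with hF₀
  have hF₀ : ∀ t, t ∈ F₀ ↔ q t = P₀ := fun t ↦ by simp [hF₀]
  set N : ℕ := F₀.card with hN
  set tf : Fin N → T := fun i ↦ (F₀.equivFin.symm i : T) with htf
  have htfinj : Function.Injective tf := fun i j hij ↦ F₀.equivFin.symm.injective (Subtype.ext hij)
  have htfq : ∀ i, q (tf i) = P₀ := fun i ↦ (hF₀ _).1 (F₀.equivFin.symm i).2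
  -- the case `d = 0`: `T` is discrete
  have hprojloc : IsLocalHomeomorph (coordMap S x ∘ q) := (isLocalHomeomorph_coordMap S d x).comp hq.isLocalHomeomorph
  rcases Nat.eq_zero_or_pos d with hd | hd
  · -- `T` is discrete: take the index on the fibre and `F = τ ∏ (τ - i)`
    subst hd
    haveI : DiscreteTopology T := discreteTopology_of_isLocallyInjective hprojloc.isLocallyInjective
    set h : T → ℂ := fun t ↦ if ht : q t = P₀ then (F₀.equivFin ⟨t, (hF₀ t).2 ht⟩ : ℂ) else 0 with hh_def
    refine ⟨h, Polynomial.X * ∏ i ∈ Finset.range N, (Polynomial.X - Polynomial.C (i : Γ(S.left, ⊤))),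
      continuous_of_discreteTopology, ?_, fun t ↦ ?_, ?_⟩
    · exact mul_ne_zero Polynomial.X_ne_zero (Finset.prod_ne_zero_iff.2 fun i _ ↦ Polynomial.X_sub_C_ne_zero _)
    · simp only [Polynomial.map_mul, Polynomial.map_X, Polynomial.map_prod, Polynomial.map_sub,
        map_natCast, Polynomial.eval_mul, Polynomial.eval_X, Polynomial.eval_prod, Polynomial.eval_sub]
      by_cases ht : q t = P₀
      · refine mul_eq_zero_of_right _ (Finset.prod_eq_zero (Finset.mem_range.2 (F₀.equivFin ⟨t, (hF₀ t).2 ht⟩).2) ?_)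
        simp [hh_def, ht]
      · simp [hh_def, ht]
    · intro t₁ ht₁ t₂ ht₂ heqh
      have h₁ : q t₁ = P₀ := ht₁
      have h₂ : q t₂ = P₀ := ht₂
      simp only [hh_def, h₁, h₂, dite_true, Nat.cast_inj] at heqh
      have := F₀.equivFin.injective (Fin.ext heqh)
      exact congrArg Subtype.val this
  haveI : Nonempty (Fin d) := ⟨⟨0, hd⟩⟩
  -- `T` is σ-compact and second countable
  obtain ⟨M, hgen, hhgen⟩ := exists_isClosedImmersion_homOfVector S
  haveI : SigmaCompactSpace (ComplexPoints S) := (isClosedEmbedding_coordMap S hgen hhgen).sigmaCompactSpace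
  haveI : SigmaCompactSpace T := ⟨⟨fun n ↦ q ⁻¹' compactCovering (ComplexPoints S) n,
    fun n ↦ hqprop.isCompact_preimage (isCompact_compactCovering _ n),
    by rw [← preimage_iUnion, iUnion_compactCovering, preimage_univ]⟩⟩
  letI : ChartedSpace (Fin d → ℂ) T := Literature.Geometry.Manifold.liftChartedSpace hprojloc
  haveI : SecondCountableTopology T := ChartedSpace.secondCountable_of_sigmaCompact (Fin d → ℂ) T
  -- the Riemann domain
  set D : RiemannDomain (Fin d) := riemannDomain S d x hq with hD
  have hproj : D.proj = coordMap S x ∘ q := rfl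
  -- flat-holomorphic regular functions and the exhaustion
  have hW : ∀ w : Γ(S.left, ⊤), IsFlatHolomorphic D fun t : T ↦ (q t).eval ⊤ trivial w :=
    isFlatHolomorphic_eval S d x hq
  set Wf : Fin M ⊕ Fin d → D → ℂ := Sum.elim (fun m t ↦ (q t).eval ⊤ trivial (hgen m)) (fun k t ↦ D.proj t k) with hWf
  have hWf : ∀ m', IsFlatHolomorphic D (Wf m') := by
    rintro (m | k)
    · exact hW (hgen m)
    · exact IsFlatHolomorphic.proj_apply k
  set s : D → ℝ := fun t ↦ ∑ m', ‖Wf m' t‖ ^ 2 with hs_def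
  have hs : ContMDiff 𝓘(ℝ, Fin d → ℂ) 𝓘(ℝ, ℝ) ∞ s := contMDiff_sum_normSq hWf
  have hsLevi : ∀ (t : D) (v : Fin d → ℂ), (fun _ ↦ (1 : ℝ)) t * ∑ j, ‖v j‖ ^ 2 ≤
      (∑ j, ∑ k, del (Pi.single j 1) (dbar (Pi.single k 1) (fun y ↦ (s y : ℂ))) t * v j * conj (v k)).re :=
    fun t v ↦ re_levi_sum_normSq_ge hWf ⟨Sum.inr, Sum.inr_injective⟩ (fun k ↦ rfl) t v
  have hsK : ∀ b : ℝ, IsCompact {t : D | s t ≤ b} := by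
    intro b
    have hprop' : IsProperMap fun (t : D) (m : Fin M) ↦ (q t).eval ⊤ trivial (hgen m) :=
      (isProperMap_coordMap S hgen hhgen).comp hqprop
    have h1 := isCompact_sublevel_sum_normSq (D := D) (W := fun m t ↦ (q t).eval ⊤ trivial (hgen m)) hprop' b
    refine h1.of_isClosed_subset (isClosed_le hs.continuous continuous_const) fun t ht ↦ ?_
    have ht' : s t ≤ b := ht
    show ∑ m, ‖(q t).eval ⊤ trivial (hgen m)‖ ^ 2 ≤ b
    have hsplit : s t = ∑ m, ‖(q t).eval ⊤ trivial (hgen m)‖ ^ 2 + ∑ k, ‖D.proj t k‖ ^ 2 := by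
      rw [hs_def]; dsimp only; rw [Fintype.sum_sum_type]; rfl
    rw [hsplit] at ht'
    linarith [Finset.sum_nonneg fun k (_ : k ∈ (Finset.univ : Finset (Fin d))) ↦ sq_nonneg ‖D.proj t k‖]
  -- the weight `φ₀ = log(1 + |proj|²)`
  set φ₀ : D → ℝ := D.pointWeight 0 1 with hφ₀_def
  have hφ₀ : ContMDiff 𝓘(ℝ, Fin d → ℂ) 𝓘(ℝ, ℝ) ∞ φ₀ := contMDiff_pointWeight 0 one_ne_zero
  set c₀ : D → ℝ := fun y ↦ (1 : ℝ) ^ 2 * (D.distSq 0 y + 1 ^ 2)⁻¹ ^ 2 with hc₀_def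
  have hc₀ : Continuous c₀ := by
    refine continuous_const.mul ((((contMDiff_distSq (D := D) 0).continuous.add continuous_const).inv₀ ?_).pow 2)
    intro y; exact (distSq_add_sq_pos (D := D) 0 one_ne_zero y).ne'
  have hc₀0 : ∀ y, 0 < c₀ y := fun y ↦ by
    have := distSq_add_sq_pos (D := D) 0 one_ne_zero y
    positivity
  have hLevi₀ : ∀ (y : D) (v : Fin d → ℂ), c₀ y * ∑ j, ‖v j‖ ^ 2 ≤
      (∑ j, ∑ k, del (Pi.single j 1) (dbar (Pi.single k 1) (fun z ↦ (φ₀ z : ℂ))) y * v j * conj (v k)).re :=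
    fun y v ↦ re_levi_pointWeight_ge (D := D) (z₀ := 0) one_ne_zero y v
  -- interpolation on the fibre of `P₀`
  set z₀ : Fin d → ℂ := coordMap S x P₀ with hz₀
  have htz : ∀ i, D.proj (tf i) = z₀ := fun i ↦ by show coordMap S x (q (tf i)) = z₀; rw [htfq]
  obtain ⟨h, hhc, hhol, hval, hmem⟩ := exists_flatHolomorphic_interpolating (D := D) hφ₀ hs hsK hc₀ hc₀0
    continuous_const (fun _ ↦ one_pos) hLevi₀ hsLevi htfinj htz (fun i ↦ (i : ℂ))
  have hflat : IsFlatHolomorphic D h := ⟨hhol⟩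
  -- injectivity on the fibre
  have hinj : InjOn h (q ⁻¹' {P₀}) := by
    intro t₁ ht₁ t₂ ht₂ heqh
    have h1 : ∀ t, q t = P₀ → ∃ i, tf i = t := fun t ht ↦
      ⟨F₀.equivFin ⟨t, (hF₀ t).2 ht⟩, by simp [htf]⟩
    obtain ⟨i₁, rfl⟩ := h1 t₁ ht₁
    obtain ⟨i₂, rfl⟩ := h1 t₂ ht₂
    rw [hval, hval] at heqh
    have : (i₁ : ℕ) = i₂ := by exact_mod_cast heqh
    rw [Fin.ext this]
  -- generic finiteness of `x`: `proj` is a finite covering over `Ω = {δ ≠ 0}`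
  obtain ⟨δ, hδ, hKc⟩ := exists_isCompact_preimage_coordMap S d x
  set Ω : Set (Fin d → ℂ) := {w | MvPolynomial.eval w δ ≠ 0} with hΩ
  have hΩopen : IsOpen Ω := isOpen_ne_fun (MvPolynomial.continuous_eval δ) continuous_const
  have hKΩ : ∀ K ⊆ Ω, IsCompact K → IsCompact (D.proj ⁻¹' K) := fun K hK hKc' ↦ by
    show IsCompact (q ⁻¹' (coordMap S x ⁻¹' K)); exact hqprop.isCompact_preimage (hKc K hK hKc')
  obtain ⟨hcov, hfinΩ⟩ := isCoveringMapOn_of_isCompact_preimage (D := D) hΩopen hKΩ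
  obtain ⟨C₁, hC₁, hgrow⟩ := IsFlatHolomorphic.exists_norm_le_of_memLp (D := D) hcov
  -- the weight as a function of `proj`
  set g : (Fin d → ℂ) → ℝ := fun w ↦ Real.log ((∑ k, ‖w k - (0 : Fin d → ℂ) k‖ ^ 2) + (1 : ℝ) ^ 2) +
      (Fintype.card (Fin d) : ℝ) * Real.log ((∑ k, ‖w k - z₀ k‖ ^ 2) + (1 : ℝ) ^ 2) with hg_def
  have hgproj : g ∘ D.proj = D.regWeight φ₀ z₀ 1 := rfl
  have hpos1 : ∀ (c : Fin d → ℂ) (w : Fin d → ℂ), 0 < (∑ k, ‖w k - c k‖ ^ 2) + (1 : ℝ) ^ 2 := fun c w ↦ by positivity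
  have hgc : Continuous g := by
    refine ((Continuous.log (by fun_prop) fun w ↦ (hpos1 0 w).ne')).add
      (continuous_const.mul (Continuous.log (by fun_prop) fun w ↦ (hpos1 z₀ w).ne'))
  have hmem' : MemLp h 2 (D.volW (g ∘ D.proj)) := by rw [hgproj]; exact hmem
  set E : ℝ := (eLpNorm h 2 (D.volW (g ∘ D.proj))).toReal ^ 2 with hE
  -- `e^{g} ≤ Bf z` on `closedBall z 1`
  set Bf : (Fin d → ℂ) → ℝ := fun z ↦ (d * (‖z‖ + 1) ^ 2 + 1) * (d * (‖z‖ + ‖z₀‖ + 1) ^ 2 + 1) ^ d with hBf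
  have hsumsq : ∀ (c w : Fin d → ℂ), ∑ k, ‖w k - c k‖ ^ 2 ≤ d * ‖w - c‖ ^ 2 := fun c w ↦ by
    calc ∑ k, ‖w k - c k‖ ^ 2 ≤ ∑ _k : Fin d, ‖w - c‖ ^ 2 :=
          Finset.sum_le_sum fun k _ ↦ pow_le_pow_left₀ (norm_nonneg _) (norm_le_pi_norm (w - c) k) 2
      _ = d * ‖w - c‖ ^ 2 := by simp
  have hBfle : ∀ z, ∀ w ∈ closedBall z 1, Real.exp (g w) ≤ Bf z := by
    intro z w hw
    rw [mem_closedBall, dist_eq_norm] at hw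
    have hw1 : ‖w‖ ≤ ‖z‖ + 1 := by
      have := norm_le_norm_add_norm_sub' w z; linarith
    have hw2 : ‖w - z₀‖ ≤ ‖z‖ + ‖z₀‖ + 1 := by
      have := norm_sub_le w z₀; linarith
    have hexp : Real.exp (g w) = ((∑ k, ‖w k - (0 : Fin d → ℂ) k‖ ^ 2) + 1 ^ 2) *
        ((∑ k, ‖w k - z₀ k‖ ^ 2) + 1 ^ 2) ^ d := by
      rw [hg_def]; dsimp only
      rw [Real.exp_add, Real.exp_log (hpos1 0 w), Fintype.card_fin, Real.exp_nat_mul, Real.exp_log (hpos1 z₀ w)]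
    rw [hexp, hBf]
    have e1 : (∑ k, ‖w k - (0 : Fin d → ℂ) k‖ ^ 2) + 1 ^ 2 ≤ d * (‖z‖ + 1) ^ 2 + 1 := by
      have := hsumsq 0 w
      rw [sub_zero] at this
      nlinarith [mul_le_mul_of_nonneg_left (pow_le_pow_left₀ (norm_nonneg w) hw1 2) (Nat.cast_nonneg d)]
    have e2 : (∑ k, ‖w k - z₀ k‖ ^ 2) + 1 ^ 2 ≤ d * (‖z‖ + ‖z₀‖ + 1) ^ 2 + 1 := by
      have := hsumsq z₀ w
      nlinarith [mul_le_mul_of_nonneg_left (pow_le_pow_left₀ (norm_nonneg _) hw2 2) (Nat.cast_nonneg d)]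
    exact mul_le_mul e1 (pow_le_pow_left₀ (hpos1 z₀ w).le e2 d) (by positivity) (by positivity)
  have hBfPG : PolyGrowth Bf := by
    have hn : PolyGrowth fun z : Fin d → ℂ ↦ ‖z‖ := PolyGrowth.norm
    exact ((((PolyGrowth.const (d : ℝ)).mul ((hn.add (PolyGrowth.const 1)).pow 2)).add (PolyGrowth.const 1)).mul
      ((((PolyGrowth.const (d : ℝ)).mul (((hn.add (PolyGrowth.const ‖z₀‖)).add (PolyGrowth.const 1)).pow 2)).add
        (PolyGrowth.const 1)).pow d))
  -- the radius of a good ball and the pointwise bound on the sheets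
  obtain ⟨Cρ, hCρ, kρ, hρ⟩ := MvPolynomial.exists_radius δ
  set Φ : (Fin d → ℂ) → ℝ := fun z ↦ C₁ * (Cρ * (1 + ‖z‖) ^ kρ) ^ (2 * d) * (E + Bf z) with hΦ
  have hΦPG : PolyGrowth Φ := by
    have hn : PolyGrowth fun z : Fin d → ℂ ↦ ‖z‖ := PolyGrowth.norm
    exact ((PolyGrowth.const C₁).mul (((PolyGrowth.const Cρ).mul (((PolyGrowth.const 1).add hn).pow kρ)).pow (2 * d))).mul
      ((PolyGrowth.const E).add hBfPG)
  set hflat_fn : D → ℂ := fun t ↦ MvPolynomial.eval (D.proj t) δ ^ (2 * d) * h t with hflat_fn_def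
  have hbound : ∀ t : D, ‖hflat_fn t‖ ≤ Φ (D.proj t) := by
    intro t
    set z := D.proj t with hz
    by_cases hzΩ : MvPolynomial.eval z δ = 0
    · have : hflat_fn t = 0 := by
        simp only [hflat_fn_def, ← hz, hzΩ]
        rw [zero_pow (by omega), zero_mul]
      rw [this, norm_zero, hΦ]
      have hE0 : 0 ≤ E := by positivity
      have hB0 : 0 ≤ Bf z := by rw [hBf]; positivity
      positivity
    obtain ⟨ρ, hρ0, hρ1, hball, hρinv⟩ := hρ z hzΩ
    have h1 := hgrow hflat hgc hmem' t ρ hρ0 hρ1 hball (Bf z) fun w hw ↦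
      hBfle z w (closedBall_subset_closedBall hρ1 hw)
    rw [← hE] at h1
    have hdz : 0 < ‖MvPolynomial.eval z δ‖ := norm_pos_iff.2 hzΩ
    -- `|δ(z)| ρ⁻¹ ≤ Cρ (1 + |z|)^kρ`
    have hkey : ‖MvPolynomial.eval z δ‖ * ρ⁻¹ ≤ Cρ * (1 + ‖z‖) ^ kρ := by
      have := mul_le_mul_of_nonneg_left hρinv hdz.le
      rwa [mul_div_cancel₀ _ hdz.ne'] at this
    have hEB : 0 ≤ E + Bf z := by
      have : 0 ≤ Bf z := by rw [hBf]; positivity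
      positivity
    calc ‖hflat_fn t‖ = ‖MvPolynomial.eval z δ‖ ^ (2 * d) * ‖h t‖ := by
          rw [hflat_fn_def]; dsimp only; rw [norm_mul, norm_pow]
      _ ≤ ‖MvPolynomial.eval z δ‖ ^ (2 * d) * (C₁ * (ρ ^ (2 * Fintype.card (Fin d)))⁻¹ * (E + Bf z)) :=
          mul_le_mul_of_nonneg_left h1 (by positivity)
      _ = C₁ * (‖MvPolynomial.eval z δ‖ * ρ⁻¹) ^ (2 * d) * (E + Bf z) := by
          rw [Fintype.card_fin, mul_pow, ← inv_pow]; ring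
      _ ≤ C₁ * (Cρ * (1 + ‖z‖) ^ kρ) ^ (2 * d) * (E + Bf z) := by
          gcongr
      _ = Φ z := rfl
  obtain ⟨CΦ, hCΦ, KΦ, hΦle⟩ := hΦPG
  have hflatb : IsFlatHolomorphic D hflat_fn := by
    have hδflat : IsFlatHolomorphic D fun t ↦ MvPolynomial.eval (D.proj t) δ := by
      refine ⟨fun e he ↦ ?_⟩
      refine ((BranchedCoveringSCV.differentiable_eval δ).differentiableOn).congr fun z hz ↦ ?_
      simp only [comp_apply, ← he]
      rw [e.right_inv hz]
    exact (hδflat.pow (2 * d)).mul hflat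
  have hgrowth : ∀ t : D, ‖hflat_fn t‖ ≤ CΦ * (1 + ‖D.proj t‖) ^ KΦ := fun t ↦
    (hbound t).trans ((le_abs_self _).trans (hΦle _))
  -- the characteristic polynomial of `δ(proj)^{2d} h` with polynomial coefficients
  obtain ⟨R, hRmonic, hRroot⟩ := exists_charPoly_of_isCoveringMapOn (D := D) hδ hcov hfinΩ hflatb hgrowth
  -- algebraization through `ℂ[X] → Γ(S, 𝒪_S)`, `Xᵢ ↦ xᵢ`
  set gS : MvPolynomial (Fin d) ℂ →+* Γ(S.left, ⊤) := MvPolynomial.eval₂Hom (structureMap S) x with hgS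
  set a : Γ(S.left, ⊤) := gS δ ^ (2 * d) with ha
  set F : Polynomial Γ(S.left, ⊤) := (R.map gS).comp (Polynomial.C a * Polynomial.X) with hF
  have hevgS : ∀ t : T, ((q t).evalRingHom ⊤ trivial).comp gS = MvPolynomial.eval (D.proj t) := fun t ↦
    evalRingHom_comp_eval₂Hom S d x (q t)
  -- `gS δ ≠ 0`: otherwise `δ` would vanish on the open image `x(S(ℂ)) ∋ x(P₀)`
  have hgSδ : gS δ ≠ 0 := by
    intro h0
    have hvan : ∀ P : ComplexPoints S, MvPolynomial.eval (coordMap S x P) δ = 0 := fun P ↦ by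
      have := RingHom.congr_fun (evalRingHom_comp_eval₂Hom S d x P) δ
      rw [RingHom.comp_apply, ← hgS, h0, map_zero] at this
      exact this.symm
    have hopen : IsOpen (range (coordMap S x)) := (isLocalHomeomorph_coordMap S d x).isOpenMap.isOpen_range
    obtain ⟨w, ⟨P, rfl⟩, hw1⟩ := (BranchedCoveringSCV.dense_setOf_eval_ne_zero hδ).inter_open_nonempty _ hopen ⟨_, P₀, rfl⟩
    exact hw1 (hvan P)
  have ha0 : a ≠ 0 := pow_ne_zero _ hgSδ
  refine ⟨h, F, hhc, ?_, fun t ↦ ?_, hinj⟩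
  · -- `F ≠ 0`
    rw [hF, Ne, Polynomial.comp_eq_zero_iff, not_or]
    refine ⟨(hRmonic.map gS).ne_zero, fun ⟨_, hq0⟩ ↦ ha0 ?_⟩
    have := congrArg (Polynomial.coeff · 1) hq0
    simpa using this
  · -- the root relation
    have hmap : (F.map ((q t).evalRingHom ⊤ trivial)) =
        (R.map (MvPolynomial.eval (D.proj t))).comp
          (Polynomial.C (MvPolynomial.eval (D.proj t) δ ^ (2 * d)) * Polynomial.X) := by
      have hevδ : (q t).evalRingHom ⊤ trivial (gS δ) = MvPolynomial.eval (D.proj t) δ := by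
        have := RingHom.congr_fun (hevgS t) δ
        rwa [RingHom.comp_apply] at this
      rw [hF, Polynomial.map_comp, Polynomial.map_map, hevgS, Polynomial.map_mul, Polynomial.map_C, Polynomial.map_X,
        ha, map_pow, hevδ]
    rw [hmap, Polynomial.eval_comp, Polynomial.eval_mul, Polynomial.eval_C, Polynomial.eval_X]
    exact hRroot t

end SmoothAffineCore

end Literature.AlgebraicGeometry.FundamentalGroup
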